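import Mathlib
import Summits.Ventures.PercRepro2.TypedFactor
import Summits.Ventures.PercRepro2.TypedUntouchedMarks

/-!
# The separated class of row 2′TRI, I: sides, the kernel on separated states, factorisation tools
(blind cell PercRepro2, night-3 g5, 2026-08-25; `proofs/NIGHT3-CERT.md` §14.4–14.7)

A typed instance `(F, z, τ)` is SEPARATED (`Sep`) when `a₁ ↮ a₂` in `z ∪ F` (`zF`, every typed
edge open).  `FL v` = the typed edges touching the component of `v` in `z ∪ F`; the `l`-side
`FL a₁` and the `h`-side `FL a₂` are disjoint (`disjoint_FL`), and on the support the cluster of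
`v` depends only on `FL v` (`cluster_restr`, domain Markov).  On separated states (case (ii):
`o, b` on the `l`-side, `a₃` on the `h`-side) the kernel `K₃` is an explicit polynomial in
`L_o, L_b, H₃` of the three copies (`KB_sepSt`, 512 cases); `st_sep` puts every copy of the
support in that form and `toNat_decide_conn_a1 / _a2` read the coordinates as the indicators
`iL` / `iH` of the side restrictions.  `typedCount_mul_three` is the three-part factorisation
(`l`-side ⊗ `h`-side ⊗ inert) from `TypedFactor.typedCount_mul_of_disjoint`.  Part II
(`TypedSeparated.lean`) assembles the identity `N = 2 · A_H · (S_same − S_cross) · T₀` and the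
theorem.
-/

namespace Summit.Ventures.PercRepro2

open UnionCluster

namespace CovForm

namespace Separated

open OneTyped TypedA3 Untouched TypedFactor

/-! ## The sides -/

section Sides

open Classical

variable {V : Type*} {E : Type*} [Fintype E] [DecidableEq E]

/-- The configuration `z ∪ F` (every typed edge open). -/
def zF (F : Finset E) (z : Config E) : Config E := fun e => z e || decide (e ∈ F)

/-- The typed edges touching the component of `v` in `z ∪ F`. -/
noncomputable def FL (ends : E → Sym2 V) (v : V) (F : Finset E) (z : Config E) : Finset E :=
  F.filter fun e => e ∈ touches ends (cluster ends (zF F z) v)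

/-- **Separated instance**: `a₁ ↮ a₂` in `z ∪ F`. -/
def Sep (ends : E → Sym2 V) (a₁ a₂ : V) (F : Finset E) (z : Config E) : Prop :=
  ¬ Conn ends (zF F z) a₂ a₁

omit [Fintype E] in
/-- `FL v ⊆ F`. -/
lemma FL_subset (ends : E → Sym2 V) (v : V) (F : Finset E) (z : Config E) :
    FL ends v F z ⊆ F := Finset.filter_subset _ _

omit [Fintype E] in
/-- An edge of `F` touching both components would join them in `z ∪ F`. -/
lemma disjoint_FL (ends : E → Sym2 V) (a₁ a₂ : V) (F : Finset E) (z : Config E)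
    (h : Sep ends a₁ a₂ F z) : Disjoint (FL ends a₁ F z) (FL ends a₂ F z) := by
  rw [Finset.disjoint_left]
  intro e h1 h2
  simp only [FL, Finset.mem_filter] at h1 h2
  obtain ⟨heF, u, hu, v, huv⟩ := h1
  obtain ⟨_, u', hu', v', huv'⟩ := h2
  have hopen : zF F z e = true := by simp [zF, heF]
  have hadj : Conn ends (zF F z) u v := conn_of_openAdj ⟨e, hopen, huv⟩
  rw [mem_cluster] at hu hu'
  have hu'1 : Conn ends (zF F z) a₁ u' := by
    rw [huv, Sym2.eq_iff] at huv'
    rcases huv' with ⟨h1, _⟩ | ⟨_, h2⟩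
    · exact h1 ▸ hu
    · exact h2 ▸ conn_trans hu hadj
  exact h (conn_trans hu' (conn_symm hu'1))

omit [Fintype E] in
/-- A configuration agreeing with `z` off `F` lies below `z ∪ F`. -/
lemma le_zF {F : Finset E} {z x : Config E} (hx : ∀ e, e ∉ F → x e = z e) : x ≤ zF F z := by
  intro e
  by_cases he : e ∈ F
  · simp [zF, he]
  · by_cases hz : z e = true <;> simp [zF, hx e he, hz]

omit [Fintype E] in
/-- On the support the cluster of `v` depends only on the typed edges at its `z ∪ F`-component
(domain Markov). -/
lemma cluster_restr (ends : E → Sym2 V) (v : V) (F : Finset E) (z : Config E)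
    {x : Config E} (hx : ∀ e, e ∉ F → x e = z e) :
    cluster ends x v = cluster ends (restr (FL ends v F z) z x) v := by
  have hsub : cluster ends x v ⊆ cluster ends (zF F z) v := cluster_mono (le_zF hx) v
  symm
  refine cluster_eq_of_eqOn_touches (ω := x) (ω' := restr (FL ends v F z) z x) ?_ rfl
  intro e he
  by_cases heF : e ∈ F
  · have heL : e ∈ FL ends v F z := by
      simp only [FL, Finset.mem_filter]
      refine ⟨heF, ?_⟩
      obtain ⟨u, hu, w, huw⟩ := he
      exact ⟨u, hsub hu, w, huw⟩
    rw [restr_of_mem heL]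
  · have heL : e ∉ FL ends v F z := by
      simp only [FL, Finset.mem_filter, not_and]
      intro h; exact absurd h heF
    rw [restr_of_not_mem heL, hx e heF]

omit [Fintype E] in
/-- Connections from `v` on the support are those of the restriction. -/
lemma conn_restr_iff (ends : E → Sym2 V) (v : V) (F : Finset E) (z : Config E)
    {x : Config E} (hx : ∀ e, e ∉ F → x e = z e) (u : V) :
    Conn ends x v u ↔ Conn ends (restr (FL ends v F z) z x) v u := by
  have h := cluster_restr ends v F z hx
  have h1 : u ∈ cluster ends x v ↔ u ∈ cluster ends (restr (FL ends v F z) z x) v := by rw [h]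
  simpa using h1

end Sides

/-! ## The kernel on separated states -/

section Kernel

/-- A separated state: `q′ = L₃ = H_o = H_b = false`. -/
def sepSt (Lo Lb H3 : Bool) : St := (false, Lo, false, Lb, false, false, H3)

/-- On separated states the kernel is an explicit eight-term polynomial (512 cases). -/
theorem KB_sepSt (Lox Lbx H3x Loy Lby H3y Low Lbw H3w : Bool) :
    KB (sepSt Lox Lbx H3x) (sepSt Loy Lby H3y) (sepSt Low Lbw H3w) =
      2 * (1 - H3x.toNat) * H3w.toNat * (Lbw.toNat * Low.toNat)
        - (1 - H3x.toNat) * Lby.toNat * Low.toNat * (1 + H3w.toNat)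
        - (1 - H3y.toNat) * Loy.toNat * (Lbw.toNat * H3w.toNat)
        + (1 - H3x.toNat) * Lox.toNat * Lby.toNat * H3w.toNat
        + (1 - H3y.toNat) * Lby.toNat * ((1 - H3w.toNat) * Low.toNat) := by
  revert Lox Lbx H3x Loy Lby H3y Low Lbw H3w
  decide +kernel

end Kernel

/-! ## Three-part factorisation and scalars -/

section Tools

variable {E : Type*} [Fintype E] [DecidableEq E] {R : Type*} [Field R]

omit [Fintype E] in
/-- Restricting to `A ⊆ D` through `D` is restricting to `A`. -/
lemma restr_restr_of_subset {A D : Finset E} (hAD : A ⊆ D) (z x : Config E) :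
    restr A z (restr D z x) = restr A z x := by
  funext e
  by_cases he : e ∈ A
  · simp [restr, he, hAD he]
  · simp [restr, he]

/-- A scalar multiple of a kernel. -/
lemma typedCount_smul' (F : Finset E) (z : Config E) (τ : E → ℕ) (c : R)
    (K : Config E → Config E → Config E → R) :
    typedCount F z τ (fun x y w => c * K x y w) = c * typedCount F z τ K := by
  unfold typedCount
  simp only [Finset.mul_sum]
  refine Finset.sum_congr rfl fun x _ => Finset.sum_congr rfl fun y _ =>
    Finset.sum_congr rfl fun w _ => ?_
  split_ifs <;> simp

/-- **Three-part factorisation**: a kernel seeing `A` through one factor and `B` through the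
other factorises over `A ∪ B ∪ C`, the inert part `C` contributing its plain count. -/
theorem typedCount_mul_three (A B C : Finset E) (hAB : Disjoint A B) (hAC : Disjoint A C)
    (hBC : Disjoint B C) (z : Config E) (τ : E → ℕ) (KA KB : Config E → Config E → Config E → R) :
    typedCount (A ∪ B ∪ C) z τ (fun x y w =>
        KA (restr A z x) (restr A z y) (restr A z w) * KB (restr B z x) (restr B z y) (restr B z w)) =
      typedCount A z τ KA * typedCount B z τ KB * typedCount C z τ (fun _ _ _ => (1 : R)) := by
  have hD : Disjoint (A ∪ B) C := Finset.disjoint_union_left.2 ⟨hAC, hBC⟩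
  have hstep : typedCount (A ∪ B ∪ C) z τ (fun x y w =>
      KA (restr A z x) (restr A z y) (restr A z w) * KB (restr B z x) (restr B z y) (restr B z w)) =
      typedCount (A ∪ B ∪ C) z τ (fun x y w =>
        (fun x' y' w' => KA (restr A z x') (restr A z y') (restr A z w') *
          KB (restr B z x') (restr B z y') (restr B z w'))
          (restr (A ∪ B) z x) (restr (A ∪ B) z y) (restr (A ∪ B) z w) *
        (fun _ _ _ => (1 : R)) (restr C z x) (restr C z y) (restr C z w)) :=
    typedCount_congr' _ _ _ _ _ fun x y w => by
      simp only [restr_restr_of_subset (Finset.subset_union_left (s₁ := A) (s₂ := B)),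
        restr_restr_of_subset (Finset.subset_union_right (s₁ := A) (s₂ := B)), mul_one]
  have h1 := typedCount_mul_of_disjoint (A ∪ B) C hD z τ
    (fun x' y' w' => KA (restr A z x') (restr A z y') (restr A z w') *
      KB (restr B z x') (restr B z y') (restr B z w')) (fun _ _ _ => (1 : R))
  have h2 := typedCount_mul_of_disjoint A B hAB z τ KA KB
  exact hstep.trans (h1.trans (by rw [h2]))

end Tools

/-! ## The states on the support -/

section States

open Classical

variable {V : Type*} {E : Type*} [Fintype E] [DecidableEq E]
variable (ends : E → Sym2 V) (o a₁ a₂ a₃ b : V)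

omit [Fintype E] in
/-- On a separated instance (case (ii)) the state of every copy is separated. -/
lemma st_sep (F : Finset E) (z : Config E) (hsep : Sep ends a₁ a₂ F z)
    (ho : o ∈ cluster ends (zF F z) a₁) (hb : b ∈ cluster ends (zF F z) a₁)
    (h3 : a₃ ∈ cluster ends (zF F z) a₂) {x : Config E} (hx : ∀ e, e ∉ F → x e = z e) :
    st ends o a₁ a₂ a₃ b x =
      sepSt (decide (Conn ends x a₁ o)) (decide (Conn ends x a₁ b)) (decide (Conn ends x a₂ a₃)) := by
  have hle : x ≤ zF F z := le_zF hx
  rw [mem_cluster] at ho hb h3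
  have hq : ¬ Conn ends x a₂ a₁ := fun h => hsep (conn_mono hle h)
  have hL3 : ¬ Conn ends x a₁ a₃ := fun h =>
    hsep (conn_trans h3 (conn_symm (conn_mono hle h)))
  have hHo : ¬ Conn ends x a₂ o := fun h => hsep (conn_trans (conn_mono hle h) (conn_symm ho))
  have hHb : ¬ Conn ends x a₂ b := fun h => hsep (conn_trans (conn_mono hle h) (conn_symm hb))
  unfold st sepSt
  simp only [hq, hL3, hHo, hHb, decide_false]

omit [Fintype E] in
/-- `L_v` on the support as an indicator of the `l`-side restriction. -/
lemma toNat_decide_conn_a1 {R : Type*} [Field R] (v : V) (F : Finset E) (z : Config E)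
    {x : Config E} (hx : ∀ e, e ∉ F → x e = z e) :
    ((decide (Conn ends x a₁ v)).toNat : R) = iL ends a₁ v (restr (FL ends a₁ F z) z x) := by
  rw [iL_eq_dec]
  by_cases h : Conn ends x a₁ v
  · have h' := (conn_restr_iff ends a₁ F z hx v).1 h
    simp [h, h']
  · have h' : ¬ Conn ends (restr (FL ends a₁ F z) z x) a₁ v :=
      fun hc => h ((conn_restr_iff ends a₁ F z hx v).2 hc)
    simp [h, h']

omit [Fintype E] in
/-- `H_v` on the support as an indicator of the `h`-side restriction. -/
lemma toNat_decide_conn_a2 {R : Type*} [Field R] (v : V) (F : Finset E) (z : Config E)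
    {x : Config E} (hx : ∀ e, e ∉ F → x e = z e) :
    ((decide (Conn ends x a₂ v)).toNat : R) = iH ends a₂ v (restr (FL ends a₂ F z) z x) := by
  rw [iH_eq_dec]
  by_cases h : Conn ends x a₂ v
  · have h' := (conn_restr_iff ends a₂ F z hx v).1 h
    simp [h, h']
  · have h' : ¬ Conn ends (restr (FL ends a₂ F z) z x) a₂ v :=
      fun hc => h ((conn_restr_iff ends a₂ F z hx v).2 hc)
    simp [h, h']

end States

end Separated

end CovForm

end Summit.Ventures.PercRepro2
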